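import Literature.MathematicalPhysics.QuantumFieldTheory.Balaban1983to89.Beta.PlaquetteVertex2Trace
import Literature.MathematicalPhysics.QuantumFieldTheory.Balaban1983to89.Beta.PlaquetteStencilData

/-!
# The `(2,2)` plaquette kernel as ONE stencil matrix on `Λ × (C × D)`, the summed `(2,2)`-jet as ONE quadratic form, and the
# contact term against a translation-invariant colour-blind propagator as a finite table

HONEST FRAMING (cell `pub-balaban`, β sub-cell, lineage an3; verbatim): discharging `BetaPertH` makes Bałaban's UV stability
UNCONDITIONAL — a real constructive-QFT result; it is NOT the continuum limit and NOT the Clay problem.  This file discharges NOTHING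
of `BetaPertH`: it is placement bookkeeping — the per-plaquette `(v ⊗ v)` kernel `M22` of `Beta.PlaquetteVertex2Coords` (any real-linear
functional `τ`, any letters `t`, any background `B`) is written as ONE matrix on the fluctuation index set `Λ × (C × D)` in the STENCIL
FORMAT of `Beta.BubbleTable` / `Beta.PlaquetteStencil` (`stencilIns`, `pairIns`, `dirBlock`), so that the finite-range / translation /
contact-term algebra of those files applies to the second-order vertex BY NAME.  ABSOLUTE RULE of the cell: no internally minted statement
enters as a cited fact; every declaration below is a definition or is kernel-proved here from the imports; NOTHING is cited.  The
manuscripts under audit are not citable for their disputed steps and are not cited here.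

## What is proved

§1 POSITION BOOKKEEPING of the plaquette `p_{μν}(x)`: directions `dir μ ν = (μ, ν, μ, ν)`, offsets `off e μ ν = (0, e μ, e ν, 0)`,
`site e x μ ν i = (x + off i, dir i)` (`site_eq`), `cv e v x μ ν i a = v (x + off i, (a, dir i))` (`cv_eq`); every offset lies in the
alphabet `PlaquetteStencilData.IsOffset e ν` (`isOffset_off`).

§2 THE PLAQUETTE STENCIL of a position–colour kernel `M : Fin 4 → Fin 4 → C → C → ℝ`:
**`plaqMat e x μ ν M := stencilIns x univ (off ∘ fst) (off ∘ snd) (fun (i,j) ↦ dirBlock (dir i) (dir j) (M i j))`**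
`= Σ_i Σ_j pairIns (x + off i) (x + off j) (dir i) (dir j) (M i j)` (`plaqMat_eq_sum`), with the quadratic-form evaluation
**`dotProduct_plaqMat_mulVec : v ⬝ᵥ plaqMat M *ᵥ w = Σ_i Σ_j Σ_a Σ_b v_i(a) · M i j a b · w_j(b)`**, finite range
(`plaqMat_apply_eq_zero_of_row/col`: an entry vanishes unless its row AND column sites are among `x + off i`) and translation covariance of
the placement (`plaqMat_translate`).

§3 THE `(2,2)` PLAQUETTE MATRIX **`P22Mat τ t e B x μ ν := plaqMat e x μ ν (M22 τ t e B x μ ν)`** with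
**`trace_P22_plaqWord_field_quadForm : τ(P22(plaqWord e (field t v) B x μ ν)) = v ⬝ᵥ P22Mat *ᵥ v`** (τ tracial), and the SUMMED
`(2,2)`-JET AS ONE MATRIX **`hess22 τ t e B := Σ_x Σ_μ Σ_ν P22Mat τ t e B x μ ν`**, **`jet22_field_quadForm : jet22 ℝ τ e (field t v) B =
v ⬝ᵥ hess22 τ t e B *ᵥ v`** — the `B`-quadratic part of the product-chart `W`-Hessian of the plaquette-word functional `Σ_p τ(U(∂p))`-jets,
in the sign and normalisation of `PlaquetteVertex2.jet22` (the Wilson action `Σ_p (1 − Re tr U(∂p))` carries the opposite sign; NOT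
restated).  `hess22` is a matrix of the quadratic form, not symmetrised.

§4 CONTACT TERMS.  Against a translation-invariant propagator with matrix-valued legs `mconvKernel g` (`g : Λ → Matrix (C × D) (C × D) ℝ`):
`trace (mconvKernel g · plaqMat M) = Σ_i Σ_j trace (g (off i − off j) · dirBlock (dir i) (dir j) (M i j))` (`BubbleTable.contact_stencil_m` BY
NAME) — values of `g` at the sixteen relative offsets `off i − off j ∈ {0, ±e μ, ±e ν, ±(e μ − e ν)}` only; `trace (G · dirBlock α β A) =
Σ_b Σ_a G_{(b,β),(a,α)} A_{ab}` (`trace_mul_dirBlock`); COLOUR-BLIND legs `cbLeg G z := 1_C ⊗ G z` (`trace_cbLeg_mul_dirBlock : … = G z β α ·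
Σ_a A a a`); and the headline, in Bałaban's letters (`𝔸 = Mat_N(ℂ)`, `rntr`, `gen τ`; `Complete τ`, `TrOrthonormal τ`, `N ≠ 0`):

  **`contact_P22Mat_colourBlind : trace (mconvKernel (cbLeg G) · P22Mat rntr (gen τ) e (field (gen τ) u) x μ ν)
      = Σ_i Σ_j G (off i − off j) (dir j) (dir i) · Σ_k Σ_l (Σ_c u_k(c) u_l(c)) · w22 N i j k l`**

(`PlaquetteVertex2Trace.sum_M22_field_diag` BY NAME) — the contact contraction of the `(2,2)` plaquette vertex against ANY
translation-invariant colour-blind fluctuation propagator is an explicit finite table: propagator values at the relative plaquette offsets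
× colour inner products of the background coordinates × the position table `w22`.

Gloss.  Placement bookkeeping only — no new numerics (the numbers are those of `PlaquetteVertex2Polar`/`Trace`).  NOT PROVED HERE, NOT
CLAIMED: any propagator or its properties, the bubble (second-order) contraction of two `(2,1)` vertices, sums over plaquettes / scales,
any value of a β-function coefficient or bound, gauge fixing/averaging, anything of `BetaPertH`, UV stability, the continuum limit or the
Clay problem.  GAPS record C-beta-an3-33 (HOME/GAPS.md of the cell).  All tags [folklore].
-/

noncomputable section

namespace Literature.MathematicalPhysics.QuantumFieldTheory.Balaban1983to89.Beta.PlaquetteVertex2Stencil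

open Finset
open scoped BigOperators Matrix
open Literature.MathematicalPhysics.QuantumFieldTheory.Balaban1983to89.Beta.BubbleTable (elemIns stencilIns mconvKernel contact_stencil_m)
open Literature.MathematicalPhysics.QuantumFieldTheory.Balaban1983to89.Beta.PlaquetteStencil (dirBlock dirBlock_apply pairIns
  dotProduct_pairIns_mulVec dotProduct_sum_mulVec)
open Literature.MathematicalPhysics.QuantumFieldTheory.Balaban1983to89.Beta.PlaquetteStencilData (IsOffset isOffset_zero isOffset_self
  isOffset_dir stencilIns_apply_eq_zero_of_row stencilIns_apply_eq_zero_of_col stencilIns_translate)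
open Literature.MathematicalPhysics.QuantumFieldTheory.Balaban1983to89.Beta.ColourTrace (Complete TrOrthonormal)
open Literature.MathematicalPhysics.QuantumFieldTheory.Balaban1983to89.Beta.PlaquetteVertex (rntr gen field plaqWord)
open Literature.MathematicalPhysics.QuantumFieldTheory.Balaban1983to89.Beta.WilsonVertex2 (P22)
open Literature.MathematicalPhysics.QuantumFieldTheory.Balaban1983to89.Beta.PlaquetteVertex2 (jet22)
open Literature.MathematicalPhysics.QuantumFieldTheory.Balaban1983to89.Beta.PlaquetteVertex2Coords (site cv M22
  trace_P22_plaqWord_field_kernel)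
open Literature.MathematicalPhysics.QuantumFieldTheory.Balaban1983to89.Beta.PlaquetteVertex2Trace (w22 sum_M22_field_diag)

/-! ## §1 Position bookkeeping of the plaquette -/

section Positions

variable {Λ : Type*} [AddCommGroup Λ] {C : Type*} {D : Type*}

/-- the DIRECTIONS of the four positions of `p_{μν}(x)`: `(μ, ν, μ, ν)`. [folklore] -/
def dir (μ ν : D) : Fin 4 → D := ![μ, ν, μ, ν]

/-- the OFFSETS of the four positions of `p_{μν}(x)` from its base point: `(0, e μ, e ν, 0)`. [folklore] -/
def off (e : D → Λ) (μ ν : D) : Fin 4 → Λ := ![0, e μ, e ν, 0]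

/-- `site e x μ ν i = (x + off i, dir i)`. [folklore] -/
theorem site_eq (e : D → Λ) (x : Λ) (μ ν : D) (i : Fin 4) : site e x μ ν i = (x + off e μ ν i, dir μ ν i) := by
  fin_cases i <;> simp [site, off, dir]

/-- the colour coordinate at position `i` reads the vector at the site `x + off i`, direction `dir i`:
`cv e v x μ ν i a = v (x + off i, (a, dir i))`. [folklore] -/
theorem cv_eq (e : D → Λ) (v : Λ × (C × D) → ℝ) (x : Λ) (μ ν : D) (i : Fin 4) (a : C) :
    cv e v x μ ν i a = v (x + off e μ ν i, (a, dir μ ν i)) := by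
  simp only [cv, site_eq]

/-- every plaquette offset lies in the alphabet `IsOffset e ν` of `PlaquetteStencilData` (`0`, `e μ`, `e ν`, `0`). [folklore] -/
theorem isOffset_off (e : D → Λ) (μ ν : D) (i : Fin 4) : IsOffset e ν (off e μ ν i) := by
  fin_cases i
  · exact isOffset_zero e ν
  · exact isOffset_dir e ν μ
  · exact isOffset_self e ν
  · exact isOffset_zero e ν

end Positions

/-! ## §2 The plaquette stencil of a position–colour kernel -/

section Stencil

variable {Λ : Type*} [DecidableEq Λ] [AddCommGroup Λ] {C : Type*} {D : Type*} [DecidableEq D]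

/-- the BLOCK FAMILY of a position–colour kernel: at the position pair `(i,j)` the colour matrix `M i j` placed in the direction block
`(dir i, dir j)`. [folklore] -/
def blk (μ ν : D) (M : Fin 4 → Fin 4 → C → C → ℝ) (s : Fin 4 × Fin 4) : Matrix (C × D) (C × D) ℝ :=
  dirBlock (dir μ ν s.1) (dir μ ν s.2) (Matrix.of fun a b => M s.1 s.2 a b)

/-- **THE PLAQUETTE STENCIL** of a position–colour kernel `M`: ONE matrix on `Λ × (C × D)`, in the `stencilIns` format of `BubbleTable`,
based at `x`, with the sixteen position pairs as stencil points, row offsets `off i`, column offsets `off j`. [folklore] -/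
def plaqMat (e : D → Λ) (x : Λ) (μ ν : D) (M : Fin 4 → Fin 4 → C → C → ℝ) : Matrix (Λ × (C × D)) (Λ × (C × D)) ℝ :=
  stencilIns x Finset.univ (fun s : Fin 4 × Fin 4 => off e μ ν s.1) (fun s => off e μ ν s.2) (blk μ ν M)

/-- the plaquette stencil is the sum of the sixteen located pairs. [folklore] -/
theorem plaqMat_eq_sum (e : D → Λ) (x : Λ) (μ ν : D) (M : Fin 4 → Fin 4 → C → C → ℝ) :
    plaqMat e x μ ν M = ∑ i, ∑ j, pairIns (x + off e μ ν i) (x + off e μ ν j) (dir μ ν i) (dir μ ν j)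
      (Matrix.of fun a b => M i j a b) := by
  simp only [plaqMat, stencilIns, blk, pairIns, Fintype.sum_prod_type]

/-- **QUADRATIC-FORM EVALUATION**: `v ⬝ᵥ plaqMat M *ᵥ w = Σ_i Σ_j Σ_a Σ_b v_i(a) · M i j a b · w_j(b)` in the plaquette's colour
coordinates `cv`. [folklore] -/
theorem dotProduct_plaqMat_mulVec [Fintype Λ] [Fintype C] [Fintype D] (e : D → Λ) (x : Λ) (μ ν : D)
    (M : Fin 4 → Fin 4 → C → C → ℝ) (v w : Λ × (C × D) → ℝ) :
    v ⬝ᵥ (plaqMat e x μ ν M *ᵥ w) = ∑ i, ∑ j, ∑ a, ∑ b, cv e v x μ ν i a * M i j a b * cv e w x μ ν j b := by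
  rw [plaqMat_eq_sum, dotProduct_sum_mulVec]
  refine Finset.sum_congr rfl fun i _ => ?_
  rw [dotProduct_sum_mulVec]
  refine Finset.sum_congr rfl fun j _ => ?_
  rw [dotProduct_pairIns_mulVec]
  simp only [cv_eq, Matrix.of_apply]

/-- FINITE RANGE (rows): an entry whose row site is none of the four `x + off i` vanishes. [folklore] -/
theorem plaqMat_apply_eq_zero_of_row (e : D → Λ) (x : Λ) (μ ν : D) (M : Fin 4 → Fin 4 → C → C → ℝ) {p : Λ × (C × D)}
    (q : Λ × (C × D)) (h : ∀ i, p.1 ≠ x + off e μ ν i) : plaqMat e x μ ν M p q = 0 :=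
  stencilIns_apply_eq_zero_of_row x _ _ _ _ q fun s _ => h s.1

/-- FINITE RANGE (columns): an entry whose column site is none of the four `x + off j` vanishes. [folklore] -/
theorem plaqMat_apply_eq_zero_of_col (e : D → Λ) (x : Λ) (μ ν : D) (M : Fin 4 → Fin 4 → C → C → ℝ) (p : Λ × (C × D))
    {q : Λ × (C × D)} (h : ∀ j, q.1 ≠ x + off e μ ν j) : plaqMat e x μ ν M p q = 0 :=
  stencilIns_apply_eq_zero_of_col x _ _ _ _ p fun s _ => h s.2

/-- TRANSLATION COVARIANCE of the placement: the stencil of the SAME kernel based at `x + a` is the one based at `x` read at the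
back-translated indices (the kernel's own covariance, `B ↦ B(· + a)`, is not restated here). [folklore] -/
theorem plaqMat_translate (e : D → Λ) (x a : Λ) (μ ν : D) (M : Fin 4 → Fin 4 → C → C → ℝ) (p q : Λ × (C × D)) :
    plaqMat e (x + a) μ ν M p q = plaqMat e x μ ν M (p.1 - a, p.2) (q.1 - a, q.2) :=
  stencilIns_translate x a _ _ _ _ p q

end Stencil

/-! ## §3 The `(2,2)` plaquette matrix and the summed `(2,2)`-jet as one quadratic form -/

section Jet

variable {𝔸 : Type*} [NormedRing 𝔸] [NormedAlgebra ℝ 𝔸]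
variable {Λ : Type*} [DecidableEq Λ] [AddCommGroup Λ] {C : Type*} [Fintype C] {D : Type*} [DecidableEq D]

/-- **THE `(2,2)` PLAQUETTE MATRIX**: the plaquette stencil of the kernel `M22 τ t e B x μ ν` of `PlaquetteVertex2Coords`. [folklore] -/
def P22Mat (τ : 𝔸 →ₗ[ℝ] ℝ) (t : C → 𝔸) (e : D → Λ) (B : Λ → D → 𝔸) (x : Λ) (μ ν : D) :
    Matrix (Λ × (C × D)) (Λ × (C × D)) ℝ :=
  plaqMat e x μ ν (M22 τ t e B x μ ν)

/-- **THE `(2,2)` COEFFICIENT OF ONE PLAQUETTE WORD IS THE QUADRATIC FORM OF ITS STENCIL MATRIX**: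
`τ(P22(plaqWord e (field t v) B x μ ν)) = v ⬝ᵥ P22Mat *ᵥ v` (τ tracial). [folklore] -/
theorem trace_P22_plaqWord_field_quadForm [Fintype Λ] [Fintype D] (τ : 𝔸 →ₗ[ℝ] ℝ) (hτ : ∀ a b : 𝔸, τ (a * b) = τ (b * a))
    (t : C → 𝔸) (e : D → Λ) (v : Λ × (C × D) → ℝ) (B : Λ → D → 𝔸) (x : Λ) (μ ν : D) :
    τ (P22 ℝ (plaqWord e (field t v) B x μ ν)) = v ⬝ᵥ (P22Mat τ t e B x μ ν *ᵥ v) := by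
  rw [trace_P22_plaqWord_field_kernel τ hτ, P22Mat, dotProduct_plaqMat_mulVec]
  refine Finset.sum_congr rfl fun i _ => Finset.sum_congr rfl fun j _ =>
    Finset.sum_congr rfl fun a _ => Finset.sum_congr rfl fun b _ => ?_
  ring

/-- **THE SUMMED `(2,2)`-JET AS ONE MATRIX**: `hess22 τ t e B := Σ_x Σ_μ Σ_ν P22Mat τ t e B x μ ν` — the `B`-quadratic part of the
product-chart `W`-Hessian of the plaquette-word functional, in the sign/normalisation of `PlaquetteVertex2.jet22`. [folklore] -/
def hess22 [Fintype Λ] [Fintype D] (τ : 𝔸 →ₗ[ℝ] ℝ) (t : C → 𝔸) (e : D → Λ) (B : Λ → D → 𝔸) :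
    Matrix (Λ × (C × D)) (Λ × (C × D)) ℝ :=
  ∑ x, ∑ μ, ∑ ν, P22Mat τ t e B x μ ν

/-- **`jet22 ℝ τ e (field t v) B = v ⬝ᵥ hess22 τ t e B *ᵥ v`** (τ tracial). [folklore] -/
theorem jet22_field_quadForm [Fintype Λ] [Fintype D] (τ : 𝔸 →ₗ[ℝ] ℝ) (hτ : ∀ a b : 𝔸, τ (a * b) = τ (b * a)) (t : C → 𝔸)
    (e : D → Λ) (v : Λ × (C × D) → ℝ) (B : Λ → D → 𝔸) :
    jet22 ℝ τ e (field t v) B = v ⬝ᵥ (hess22 τ t e B *ᵥ v) := by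
  simp only [jet22, hess22, dotProduct_sum_mulVec, trace_P22_plaqWord_field_quadForm τ hτ]

end Jet

/-! ## §4 Contact terms against translation-invariant propagators -/

section Contact

variable {Λ : Type*} [Fintype Λ] [DecidableEq Λ] [AddCommGroup Λ] {C : Type*} [Fintype C] [DecidableEq C]
  {D : Type*} [Fintype D] [DecidableEq D]

omit [DecidableEq C] in
/-- **CONTACT TERM OF A PLAQUETTE STENCIL** against a translation-invariant propagator with matrix-valued legs:
`trace (mconvKernel g · plaqMat M) = Σ_i Σ_j trace (g (off i − off j) · dirBlock (dir i) (dir j) (M i j))` — `BubbleTable.contact_stencil_m`;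
only the values of `g` at the sixteen relative offsets enter. [folklore] -/
theorem trace_mconvKernel_mul_plaqMat (g : Λ → Matrix (C × D) (C × D) ℝ) (e : D → Λ) (x : Λ) (μ ν : D)
    (M : Fin 4 → Fin 4 → C → C → ℝ) :
    Matrix.trace (mconvKernel g * plaqMat e x μ ν M)
      = ∑ i, ∑ j, Matrix.trace (g (off e μ ν i - off e μ ν j) * dirBlock (dir μ ν i) (dir μ ν j) (Matrix.of fun a b => M i j a b)) := by
  rw [plaqMat, contact_stencil_m, Fintype.sum_prod_type]
  rfl

omit [Fintype Λ] [DecidableEq Λ] [AddCommGroup Λ] [DecidableEq C] in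
/-- the fibre trace against a direction block: `trace (G · dirBlock α β A) = Σ_b Σ_a G_{(b,β),(a,α)} · A_{ab}`. [folklore] -/
theorem trace_mul_dirBlock (G : Matrix (C × D) (C × D) ℝ) (α β : D) (A : Matrix C C ℝ) :
    Matrix.trace (G * dirBlock α β A) = ∑ b, ∑ a, G (b, β) (a, α) * A a b := by
  rw [Matrix.trace, Fintype.sum_prod_type, Finset.sum_comm, Finset.sum_eq_single_of_mem β (Finset.mem_univ β)]
  · refine Finset.sum_congr rfl fun b _ => ?_
    rw [Matrix.diag_apply, Matrix.mul_apply, Fintype.sum_prod_type]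
    refine Finset.sum_congr rfl fun a _ => ?_
    rw [Finset.sum_eq_single_of_mem α (Finset.mem_univ α)]
    · rw [dirBlock_apply, if_pos ⟨rfl, rfl⟩]
    · intro k _ hk
      rw [dirBlock_apply, if_neg (fun h => hk h.1), mul_zero]
  · intro k' _ hk'
    refine Finset.sum_eq_zero fun b _ => ?_
    rw [Matrix.diag_apply, Matrix.mul_apply, Fintype.sum_prod_type]
    refine Finset.sum_eq_zero fun a _ => Finset.sum_eq_zero fun k _ => ?_
    rw [dirBlock_apply, if_neg (fun h => hk' h.2), mul_zero]

omit [Fintype Λ] [DecidableEq Λ] [AddCommGroup Λ] [Fintype C] [Fintype D] [DecidableEq D] in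
/-- COLOUR-BLIND LEGS: `cbLeg G z := 1_C ⊗ G z`, i.e. `(cbLeg G z)_{(a,α),(b,β)} = [a = b]·G z α β`. [folklore] -/
def cbLeg (G : Λ → Matrix D D ℝ) : Λ → Matrix (C × D) (C × D) ℝ :=
  fun z => Matrix.of fun p q => if p.1 = q.1 then G z p.2 q.2 else 0

omit [Fintype Λ] [DecidableEq Λ] [AddCommGroup Λ] in
/-- against a direction block a colour-blind leg gives the direction entry times the COLOUR TRACE of the block:
`trace (cbLeg G z · dirBlock α β A) = G z β α · Σ_a A a a`. [folklore] -/
theorem trace_cbLeg_mul_dirBlock (G : Λ → Matrix D D ℝ) (z : Λ) (α β : D) (A : Matrix C C ℝ) :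
    Matrix.trace (cbLeg (C := C) G z * dirBlock α β A) = G z β α * ∑ a, A a a := by
  rw [trace_mul_dirBlock]
  simp only [cbLeg, Matrix.of_apply, ite_mul, zero_mul, Finset.sum_ite_eq, Finset.mem_univ, if_true, Finset.mul_sum]

omit [DecidableEq C] in
/-- CONTACT TERM OF THE `(2,2)` PLAQUETTE MATRIX (any algebra, any functional, any background): `BubbleTable.contact_stencil_m` at the
kernel `M22`. [folklore] -/
theorem contact_P22Mat {𝔸 : Type*} [NormedRing 𝔸] [NormedAlgebra ℝ 𝔸] (g : Λ → Matrix (C × D) (C × D) ℝ) (τ : 𝔸 →ₗ[ℝ] ℝ)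
    (t : C → 𝔸) (e : D → Λ) (B : Λ → D → 𝔸) (x : Λ) (μ ν : D) :
    Matrix.trace (mconvKernel g * P22Mat τ t e B x μ ν)
      = ∑ i, ∑ j, Matrix.trace (g (off e μ ν i - off e μ ν j) * dirBlock (dir μ ν i) (dir μ ν j)
          (Matrix.of fun a b => M22 τ t e B x μ ν i j a b)) :=
  trace_mconvKernel_mul_plaqMat g e x μ ν _

-- Bałaban's letters: `𝔸 = Mat_N(ℂ)` with Mathlib's `L¹–L^∞` operator norm as a LOCAL instance (as in `Beta.PlaquetteVertex` §4 and
-- `Beta.PlaquetteVertex2Trace`); the statement below is norm-free.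
attribute [local instance] Matrix.linftyOpNormedRing Matrix.linftyOpNormedAlgebra

/-- **THE CONTACT TERM OF THE `(2,2)` PLAQUETTE VERTEX AGAINST A TRANSLATION-INVARIANT COLOUR-BLIND PROPAGATOR IS A FINITE TABLE**:
in Bałaban's letters (`rntr`, `gen τ`; `Complete τ`, `TrOrthonormal τ`, `N ≠ 0`), at the background `B = field (gen τ) u`,
`trace (mconvKernel (cbLeg G) · P22Mat) = Σ_i Σ_j G (off i − off j) (dir j) (dir i) · Σ_k Σ_l (Σ_c u_k(c) u_l(c)) · w22 N i j k l`.
[folklore] -/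
theorem contact_P22Mat_colourBlind {N : ℕ} {τ : C → Matrix (Fin N) (Fin N) ℂ} (hτ : Complete τ) (ho : TrOrthonormal τ)
    (hN : N ≠ 0) (G : Λ → Matrix D D ℝ) (e : D → Λ) (u : Λ × (C × D) → ℝ) (x : Λ) (μ ν : D) :
    Matrix.trace (mconvKernel (cbLeg G) * P22Mat rntr (gen τ) e (field (gen τ) u) x μ ν)
      = ∑ i, ∑ j, G (off e μ ν i - off e μ ν j) (dir μ ν j) (dir μ ν i)
          * ∑ k, ∑ l, (∑ c, cv e u x μ ν k c * cv e u x μ ν l c) * w22 N i j k l := by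
  rw [contact_P22Mat]
  refine Finset.sum_congr rfl fun i _ => Finset.sum_congr rfl fun j _ => ?_
  rw [trace_cbLeg_mul_dirBlock]
  simp only [Matrix.of_apply]
  rw [sum_M22_field_diag hτ ho hN]

end Contact

/-! ## §5 Examples -/

section Examples

variable {Λ : Type*} [AddCommGroup Λ] {D : Type*}

/-- the relative offset of positions `1` and `2` is `e μ − e ν`. [folklore] -/
example (e : D → Λ) (μ ν : D) : off e μ ν 1 - off e μ ν 2 = e μ - e ν := by
  simp [off]

/-- positions `0` and `3` share the base site (relative offset `0`): the two links of the plaquette AT `x`. [folklore] -/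
example (e : D → Λ) (μ ν : D) : off e μ ν 0 - off e μ ν 3 = 0 := by
  simp [off]

/-- the directions of positions `0` and `3` are `μ` and `ν`. [folklore] -/
example (μ ν : D) : (dir μ ν 0, dir μ ν 3) = (μ, ν) := by
  simp [dir]

end Examples

end Literature.MathematicalPhysics.QuantumFieldTheory.Balaban1983to89.Beta.PlaquetteVertex2Stencil
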